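import Mathlib
import Summits.ValiantsHypothesis.ValiantsHypothesis.Theorems.FifoMatchingNNLinearDegreeCofactorHardShedWordBalance
import Summits.ValiantsHypothesis.ValiantsHypothesis.Theorems.FifoMatchingNNLinearDegreeCofactorHardShedWordBand
import Literature.NumberTheory.LFunctions.MoebiusHarmonicSumBound
import HarnessLib

/-!
# Crux `NNLinearDegreeCofactorHard` (stmt-ValiantsHypothesis-23918), line `internal_cofactor`, stub S2b (ii):
# μ* = shedWord — GOOD ENDS and the BAND COUNT (inputs of the assembly)

* `defectCount_eq_card` — the defect counts of `ShedWordDefs` as cardinalities of subsets of `R`;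
* `hgood_of_suffix`, `hpar_of_suffix`, `freeCount_fill_ge` — the hypotheses of `balanced_of_band` / `heart_popped` from the
  interface's end densities (`4·#(R ∩ prefix) ≤ length`, `4·#(R ∩ suffix) ≤ length`);
* `balanced_drain` — with `H = E = 0` (drain from the start) the word is balanced for every bit string: the trivial measure
  used below the threshold;
* `card_band_ge` (with `Literature…MoebiusSum.exp_neg_le_div_pow_four`: `exp (−x) ≤ 24 / x⁴`) — **the band count**: if `1536 (N+1) N⁴ ≤ w⁸` then at least
  half of all bit strings satisfy `|fairWalk| < w` on `[H, E]` (Azuma, landed as `card_filter_exists_abs_fairWalk_ge_le`).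

Honest framing: bookkeeping; nothing here proves S2b, the crux or VP ≠ VNP (not proved).  No new definitions. [folklore]
-/

noncomputable section

-- Sub = Summit single-conjunct layout: the duplicated namespace component is mandated by the tree.
set_option linter.dupNamespace false

namespace Summit.ValiantsHypothesis.ValiantsHypothesis.Theorems.FifoMatching.NNLinearDegreeCofactorHard.ShedWord

open Finset Literature.Computability.AlgebraicComplexity
open Summit.ValiantsHypothesis.ValiantsHypothesis.Theorems.FifoMatching.NNMonotoneHard

variable {N : ℕ} (R : Finset (Fin N)) (H E : ℕ)

/-! ### Defect counts as subsets of `R` -/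

/-- `defectCount R a b` counts the elements of `R` with value in `[a, b)`. [folklore] -/
theorem defectCount_eq_card (a b : ℕ) :
    defectCount R a b = (R.filter fun j => a ≤ j.val ∧ j.val < b).card := by
  classical
  unfold defectCount isDefect
  rw [← card_map Fin.valEmbedding]
  congr 1
  ext u
  simp only [mem_filter, mem_range, mem_map, Fin.valEmbedding_apply, decide_eq_true_eq]
  constructor
  · rintro ⟨hub, hau, j, hj, rfl⟩
    exact ⟨j, ⟨hj, hau, hub⟩, rfl⟩
  · rintro ⟨j, ⟨hj, hau, hub⟩, rfl⟩
    exact ⟨hub, hau, j, hj, rfl⟩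

/-- The suffix defect count in the interface's form. [folklore] -/
theorem defectCount_suffix_eq (t : ℕ) (ht : t ≤ N) :
    defectCount R t N = (R.filter fun j => N ≤ j.val + (N - t)).card := by
  rw [defectCount_eq_card]
  congr 1
  ext j
  simp only [mem_filter, and_congr_right_iff]
  intro _
  have := j.isLt
  omega

/-- The prefix defect count in the interface's form. [folklore] -/
theorem defectCount_prefix_eq (t : ℕ) :
    defectCount R 0 t = (R.filter fun j => j.val < t).card := by
  rw [defectCount_eq_card]
  congr 1
  ext j
  simp only [mem_filter, zero_le, true_and]

/-- **`hgood` from the suffix density**: on every suffix the defects are fewer than the non-defects. [folklore] -/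
theorem hgood_of_suffix (hsuf : ∀ t ≤ N, 4 * (R.filter fun j => N ≤ j.val + t).card ≤ t) :
    ∀ t, E ≤ t → t < N → isDefect R t = false → defectCount R t N < freeCount R t N := by
  intro t _ htN _
  have h1 := hsuf (N - t) (Nat.sub_le _ _)
  rw [← defectCount_suffix_eq R t htN.le] at h1
  have h2 := freeCount_add_defectCount R htN.le
  omega

/-- The fill's free count is at least three quarters of the fill. [folklore] -/
theorem freeCount_fill_ge (hHN : H ≤ N) (hpre : ∀ t ≤ N, 4 * (R.filter fun j => j.val < t).card ≤ t) :
    3 * H ≤ 4 * freeCount R 0 H := by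
  have h1 := hpre H hHN
  rw [← defectCount_prefix_eq] at h1
  have h2 := freeCount_add_defectCount R (Nat.zero_le H)
  omega

/-- The fill's free count is at most the fill. [folklore] -/
theorem freeCount_fill_le : freeCount R 0 H ≤ H := by
  have h2 := freeCount_add_defectCount R (Nat.zero_le H)
  omega

/-- **`hpar` from the suffix density** for the adaptive time `E = N − 2(#R + H + w)`. [folklore] -/
theorem hpar_of_suffix (hsuf : ∀ t ≤ N, 4 * (R.filter fun j => N ≤ j.val + t).card ≤ t) {w : ℕ}
    (hfit : 2 * (R.card + H + w) ≤ N) :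
    R.card + freeCount R 0 H + w + defectCount R (N - 2 * (R.card + H + w)) N ≤
      freeCount R (N - 2 * (R.card + H + w)) N := by
  have h1 := hsuf (N - (N - 2 * (R.card + H + w))) (Nat.sub_le _ _)
  rw [← defectCount_suffix_eq R _ (Nat.sub_le _ _)] at h1
  have h2 := freeCount_add_defectCount R (Nat.sub_le N (2 * (R.card + H + w)))
  have h3 := freeCount_fill_le R H
  omega

/-! ### The trivial measure below the threshold: drain from the start -/

/-- **Drain from the start is balanced**: with `H = E = 0` every bit string gives a balanced word, provided the suffix density
holds and `2·#R ≤ N`. [folklore] -/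
theorem balanced_drain (y : Fin N → Bool) (hN : Even N)
    (hsuf : ∀ t ≤ N, 4 * (R.filter fun j => N ≤ j.val + t).card ≤ t) :
    (closerSet (shedWord R 0 0 y)).card = (openerSet (shedWord R 0 0 y)).card := by
  refine balanced_shedWord R 0 0 y hN le_rfl (Nat.zero_le N) (hgood_of_suffix R 0 hsuf) ?_
  have h1 := hsuf (N - 0) (Nat.sub_le _ _)
  rw [← defectCount_suffix_eq R 0 (Nat.zero_le N)] at h1
  have h2 := freeCount_add_defectCount R (Nat.zero_le N)
  show height [] + defectCount R 0 N ≤ freeCount R 0 N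
  simp only [height, pushes, pops, List.count_nil, Nat.sub_zero, zero_add]
  omega

/-! ### The band count -/

/-- **THE BAND COUNT.**  If `1536 (N+1) N⁴ ≤ w⁸` (and `0 < N`, `E ≤ N`), at least half of all bit strings have `|fairWalk| < w`
at every time of `[H, E]`. [folklore] -/
theorem card_band_ge (hN : 0 < N) (hEN : E ≤ N) {w : ℕ} (hw8 : 1536 * (N + 1) * N ^ 4 ≤ w ^ 8) :
    (2 : ℝ) ^ N ≤ 2 * ((univ : Finset (Fin N → Bool)).filter
      fun y => ∀ s, H ≤ s → s ≤ E → |fairWalk R H E y s| < w).card := by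
  classical
  set BB := (univ : Finset (Fin N → Bool)).filter fun y => ∀ s, H ≤ s → s ≤ E → |fairWalk R H E y s| < w with hBB
  set Bad := (univ : Finset (Fin N → Bool)).filter fun y => ∃ t, t ≤ E ∧ (w : ℝ) ≤ |(fairWalk R H E y t : ℝ)| with hBad
  -- the complement of the band lies in `Bad`
  have hcompl : (univ : Finset (Fin N → Bool)).filter (fun y => ¬ ∀ s, H ≤ s → s ≤ E → |fairWalk R H E y s| < w) ⊆ Bad := by
    intro y hy
    rw [mem_filter] at hy
    obtain ⟨_, hy⟩ := hy
    push Not at hy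
    obtain ⟨s, _, hsE, hs⟩ := hy
    rw [hBad, mem_filter]
    refine ⟨mem_univ _, s, hsE, ?_⟩
    rw [← Int.cast_abs]
    exact_mod_cast hs
  have hcard : BB.card + ((univ : Finset (Fin N → Bool)).filter
      (fun y => ¬ ∀ s, H ≤ s → s ≤ E → |fairWalk R H E y s| < w)).card = 2 ^ N := by
    rw [hBB, card_filter_add_card_filter_not, card_univ, Fintype.card_fun, Fintype.card_bool, Fintype.card_fin]
  have hw0 : 0 < w := by
    rcases Nat.eq_zero_or_pos w with h | h
    · subst h; simp at hw8; omega
    · exact h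
  -- Azuma
  have hA := card_filter_exists_abs_fairWalk_ge_le R H E hN hEN (a := (w : ℝ)) (by positivity)
  rw [← hBad] at hA
  -- the tail estimate: `2 (E+1) exp(−w²/2N) ≤ 1/2`
  have hx : (0 : ℝ) < (w : ℝ) ^ 2 / (2 * N) := by positivity
  have hexp := Literature.NumberTheory.LFunctions.MoebiusSum.exp_neg_le_div_pow_four hx
  have hNr : (0 : ℝ) < N := by exact_mod_cast hN
  have hpoly : (1536 * (N + 1) * N ^ 4 : ℝ) ≤ (w : ℝ) ^ 8 := by exact_mod_cast hw8
  have htail : 2 * ((E : ℝ) + 1) * Real.exp (-((w : ℝ) ^ 2 / (2 * N))) ≤ 1 / 2 := by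
    have hE1 : (E : ℝ) + 1 ≤ N + 1 := by exact_mod_cast Nat.succ_le_succ hEN
    calc 2 * ((E : ℝ) + 1) * Real.exp (-((w : ℝ) ^ 2 / (2 * N)))
        ≤ 2 * ((N : ℝ) + 1) * (24 / ((w : ℝ) ^ 2 / (2 * N)) ^ 4) := by
          gcongr
      _ = (1536 * (N + 1) * N ^ 4 : ℝ) / (w : ℝ) ^ 8 * (1 / 2) := by
          field_simp
          ring
      _ ≤ 1 * (1 / 2) := by
          gcongr
          rw [div_le_one (by positivity)]
          exact hpoly
      _ = 1 / 2 := one_mul _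
  have hBadle : (Bad.card : ℝ) ≤ 2 ^ N / 2 := by
    calc (Bad.card : ℝ) ≤ 2 * (E + 1) * Real.exp (-((w : ℝ) ^ 2 / (2 * N))) * 2 ^ N := hA
      _ ≤ (1 / 2) * 2 ^ N := mul_le_mul_of_nonneg_right htail (by positivity)
      _ = 2 ^ N / 2 := by ring
  have hc := card_le_card hcompl
  have h2N : ((2 ^ N : ℕ) : ℝ) = (2 : ℝ) ^ N := by push_cast; ring
  have hsum : (BB.card : ℝ) + (((univ : Finset (Fin N → Bool)).filter
      (fun y => ¬ ∀ s, H ≤ s → s ≤ E → |fairWalk R H E y s| < w)).card : ℝ) = 2 ^ N := by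
    rw [← h2N]; exact_mod_cast hcard
  have hc' : (((univ : Finset (Fin N → Bool)).filter
      (fun y => ¬ ∀ s, H ≤ s → s ≤ E → |fairWalk R H E y s| < w)).card : ℝ) ≤ Bad.card := by exact_mod_cast hc
  linarith

end Summit.ValiantsHypothesis.ValiantsHypothesis.Theorems.FifoMatching.NNLinearDegreeCofactorHard.ShedWord

end
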